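import Mathlib
import Summits.ResolutionOfSingularities.ResolutionOfSingularities.Theorems.WildQuotientsWildQuotientResolutionJordanFourChartC
import Literature.AlgebraicGeometry.Resolution.AffineBlowupRegular

/-!
# Programme V4U: `Bl_{I₆} 𝔸ⁿ` is covered by its three vertex charts

(crux stmt-ResolutionOfSingularities-15640 `WildQuotients.WildQuotientResolution`, line `Sketch`,
sector `|G| = p`; programme V4U of `L/w45c/CHAIN.md` v5 §NEXT; [OURS · L1 W4.5c] — NOT a statement
of any manuscript.)

`Bl_{I₆} 𝔸ⁿ = D₊(x_a² t) ∪ D₊(x_b³ t) ∪ D₊(x_c⁶ t)` (the `μ₃`, `μ₂` and smooth vertex charts): the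
eight generator charts cover (Literature `affineBlowup.iSup_basicOpen_reesT_generators_eq_top`) and
the five non-vertex charts lie in vertex charts (`JordanFour.basicOpen_I6_*_le`, p489593). This is
the upstairs cover from which the V4U exit glues `Y = V/σ` out of three pieces.
-/

-- single-problem summit: the doubled namespace component `ResolutionOfSingularities` is forced
set_option linter.dupNamespace false

noncomputable section

open MvPolynomial AlgebraicGeometry Literature.AlgebraicGeometry.Resolution

namespace Summit.ResolutionOfSingularities.ResolutionOfSingularities.Theorems.WildQuotientResolution.JordanFour

/-- **The three vertex charts cover `Bl_{I₆} 𝔸ⁿ`**: `D₊(x_a² t) ⊔ D₊(x_b³ t) ⊔ D₊(x_c⁶ t) = ⊤`.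
[OURS · L1 W4.5c] [folklore] -/
theorem iSup_vertexCharts_I6_eq_top (k : Type) [Field k] (n : ℕ) (a b c : Fin n) :
    Proj.basicOpen (reesGrading (Ideal.span (Set.range
        (![X a ^ 2, X a * X b ^ 2, X a * X b * X c, X a * X c ^ 3, X b ^ 3, X b ^ 2 * X c ^ 2,
          X b * X c ^ 4, X c ^ 6] : Fin 8 → MvPolynomial (Fin n) k))))
      (reesT ((![X a ^ 2, X a * X b ^ 2, X a * X b * X c, X a * X c ^ 3, X b ^ 3, X b ^ 2 * X c ^ 2,
          X b * X c ^ 4, X c ^ 6] : Fin 8 → MvPolynomial (Fin n) k) 0) (Ideal.mem_span_range_self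
        (f := (![X a ^ 2, X a * X b ^ 2, X a * X b * X c, X a * X c ^ 3, X b ^ 3, X b ^ 2 * X c ^ 2,
          X b * X c ^ 4, X c ^ 6] : Fin 8 → MvPolynomial (Fin n) k)) (x := 0))) ⊔
    Proj.basicOpen (reesGrading (Ideal.span (Set.range
        (![X a ^ 2, X a * X b ^ 2, X a * X b * X c, X a * X c ^ 3, X b ^ 3, X b ^ 2 * X c ^ 2,
          X b * X c ^ 4, X c ^ 6] : Fin 8 → MvPolynomial (Fin n) k))))
      (reesT ((![X a ^ 2, X a * X b ^ 2, X a * X b * X c, X a * X c ^ 3, X b ^ 3, X b ^ 2 * X c ^ 2,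
          X b * X c ^ 4, X c ^ 6] : Fin 8 → MvPolynomial (Fin n) k) 4) (Ideal.mem_span_range_self
        (f := (![X a ^ 2, X a * X b ^ 2, X a * X b * X c, X a * X c ^ 3, X b ^ 3, X b ^ 2 * X c ^ 2,
          X b * X c ^ 4, X c ^ 6] : Fin 8 → MvPolynomial (Fin n) k)) (x := 4))) ⊔
    Proj.basicOpen (reesGrading (Ideal.span (Set.range
        (![X a ^ 2, X a * X b ^ 2, X a * X b * X c, X a * X c ^ 3, X b ^ 3, X b ^ 2 * X c ^ 2,
          X b * X c ^ 4, X c ^ 6] : Fin 8 → MvPolynomial (Fin n) k))))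
      (reesT ((![X a ^ 2, X a * X b ^ 2, X a * X b * X c, X a * X c ^ 3, X b ^ 3, X b ^ 2 * X c ^ 2,
          X b * X c ^ 4, X c ^ 6] : Fin 8 → MvPolynomial (Fin n) k) 7) (Ideal.mem_span_range_self
        (f := (![X a ^ 2, X a * X b ^ 2, X a * X b * X c, X a * X c ^ 3, X b ^ 3, X b ^ 2 * X c ^ 2,
          X b * X c ^ 4, X c ^ 6] : Fin 8 → MvPolynomial (Fin n) k)) (x := 7))) = ⊤ := by
  refine top_le_iff.mp ?_
  rw [← affineBlowup.iSup_basicOpen_reesT_generators_eq_top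
    (![X a ^ 2, X a * X b ^ 2, X a * X b * X c, X a * X c ^ 3, X b ^ 3, X b ^ 2 * X c ^ 2,
          X b * X c ^ 4, X c ^ 6] : Fin 8 → MvPolynomial (Fin n) k)]
  refine iSup_le fun i => ?_
  fin_cases i
  · exact le_sup_left.trans le_sup_left
  · exact (basicOpen_I6_one_le k n a b c).trans (le_sup_left.trans le_sup_left)
  · exact (basicOpen_I6_two_le k n a b c).trans le_sup_right
  · exact (basicOpen_I6_three_le k n a b c).trans le_sup_right
  · exact le_sup_right.trans le_sup_left
  · exact (basicOpen_I6_five_le k n a b c).trans le_sup_right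
  · exact (basicOpen_I6_six_le k n a b c).trans le_sup_right
  · exact le_sup_right

end Summit.ResolutionOfSingularities.ResolutionOfSingularities.Theorems.WildQuotientResolution.JordanFour

end
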